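import Summits.QuantumFields.YangMills.Theorems.FluctuationComparisonRegPrIntLLargeFieldGasFootprint
import Summits.QuantumFields.YangMills.Theorems.FluctuationComparisonRegPrIntLLargeFieldGasEntropyCriterion
import HarnessLib

/-!
# KP-ACTIVITY LETTER ON `M`-BLOCK FOOTPRINTS: ★★ `kpGasOn_of_blockDecay` — V-local activities supported on the footprints of touching-connected families of big blocks `B^μ(y)`,
# bounded on the window by `E₀·e^{−κμ·#blocks}`, form a Kotecký–Preiss gas `KPGasOn W κ N w` as soon as `E₀ ≤ N` and `E₀·d·L^{dμ} + κ·2dL^μ + 2·log(3^d − 1) + 1 ≤ κμ`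
# — the block sibling of ✓`KPGasOfGeometricActivities.kpGasOn_of_geometric` (bond-level `q^{|X|}`) and of ✓`…LargeFieldGasEntropyCriterion.exists_size_of_connected_decay`

Cell `ym3-torus` (HUMAN RULING D-0037: rung R3 = continuum `SU(2)` Yang–Mills on `T³` — NOT `d = 4`, NOT infinite volume, NOT a mass gap, NOT the Clay problem); width seat
`ym3-torus-px10` (gen 17), FILE 12; helper of the crux `stmt-QuantumFields-20520` `UnitScaleTilt.FluctuationComparisonRegPrIntL` (`--supports … --as helper`, NOT a proof of it);
a DOOR for the gas hands of S2β (GAS ∕ GAS₁ `BeyondOneLoopGasCan` ∕ `LoopLedgerDepthOneGasCan` of LINE g19-2; LFG of LINE g19-1 is served by FILES 7–10).  THEOREMS ONLY: 0 `def`,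
0 `instance`, 0 `notation`, 0 `sorry`, default heartbeats.

WHY BLOCKS (the same arithmetic that moved the LFG socket to blocks, px10 g17 STATUS 21:52Z).  A cluster expansion à la [Balaban1987RG1] (0.22)–(0.25) emits activities on unions of
`M`-cubes with tree decay `E₀e^{−κ_B d(X)}`, i.e. `≈ κ_B·M` per cube for `M` large.  The bond-level letter `|w| ≤ E₀ q^{|X|}`, `(Δ+1)² q e^{1+κr} ≤ ½` counts entropy per BOND and would
ask `q ≲ M^{−2d}` per bond, i.e. decay `≳ d M^d log M` per cube; the block letter below asks `κμ ≥ E₀·dM^d + 2dκM + 2 log(3^d − 1) + 1` per cube with the pin `E₀` and the KP rate `κ`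
at the hand's disposal (both small) — satisfiable in print's regime.
* §1 `blockWbar` bookkeeping: with `size X := |blocks of X|` (✓FILE 7 `card_image_blk_biUnion_cell`), a footprint of a touching-connected family is never empty
  (`biUnion_cell_nonempty_of_connected`), so the majorant `w̄ X := E₀ e^{−κμ·size X}` on footprints, `0` elsewhere, vanishes at `∅`.
* §2 ★★ `kpGasOn_of_blockDecay` — on `PBond P 0` of ANY torus of the tree's `Setup` (`d ≥ 1`, grain `μ ≤ m + K`): V-local real activities `w`, `w U ∅ = 0`, vanishing on the window
  off block footprints, `|w U X| ≤ E₀ e^{−κμ·#blocks(X)}` on the window, `0 ≤ E₀ ≤ N`, `0 ≤ κ`, rate row as above ⟹ the eight clauses of `KPGasOn W κ N w` (δ-unfolded) with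
  `ℓ X :=` the source-`tdist` diameter and `a` from KPL-E — CONCLUSION TEXT = ✓`kpGasOn_of_geometric`'s, token for token, so a gas hand can swap doors.  Proof =
  ✓`…EntropyCriterion.pinned_criterion_of_connected_cells_decay` (cells = blocks, `m = 1`, `s₀ = d·L^{dμ}`, `Δ = 3^d − 1`, `ℓ₀ = 2dL^μ` — all ✓FILE 7) + ✓KPL-E
  `exists_size_of_pinned_criterion`.

HONEST SCOPE.  Finite combinatorics and bookkeeping over landed theorems; NO activity of Bałaban's expansion is constructed or bounded here — the block decay `|w_U X| ≤ E₀e^{−κμ·#blocks}`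
IS the XL content of GAS₁ ∕ LFG and stays a hypothesis; CURRENCY CAVEAT as for FILE 10: `hloc` is strict V-locality in `U` (print: background-locality, [Balaban1987RG1] (0.22)–(0.24)).
`BeyondOneLoopSmallIntCan`, LF-INT∘, S2β, `FluctuationComparisonRegPrIntL` (stmt-QuantumFields-20520) NOT proved; rung R3 = SU(2) YM₃ on T³ at fixed lattice data — NOT d = 4,
NOT infinite volume, NOT a mass gap, NOT Clay; the Yang–Mills mass gap is NOT proved.
References: [Balaban1987RG1] T. Bałaban, CMP 109 (1987) (0.22)–(0.26) pp.256–257; [Balaban1989LargeFieldII] CMP 122 (1989) (1.84) p.386, (1.97)–(1.100) pp.389–390;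
[KoteckyPreiss1986] CMP 103 (1986), Theorem p.492 (1).
-/

set_option autoImplicit false

noncomputable section

open Finset
open scoped BigOperators
open Literature.Probability.LatticeModels (polyInc)
open Literature.MathematicalPhysics.QuantumFieldTheory.Balaban1983to89
open Literature.MathematicalPhysics.QuantumFieldTheory.Balaban1983to89.Node00 (touchingGraph SiteTouch degree_touchingGraph_siteTouch_le_pred)
open Literature.MathematicalPhysics.QuantumFieldTheory.Balaban1983to89.B5Eq118OneStroke (iterBlockOf iterBlock card_iterBlock)
open Summit.QuantumFields.YangMills.Theorems.FluctuationComparisonRegPrIntLLargeFieldGasFootprint (mem_biUnion_cell_iff card_image_blk_biUnion_cell iterBlockOf_embIter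
  supDiam_biUnion_cell_le footprint_hdiam card_filter_mem_cell_le_one card_cell_le one_le_three_pow_sub_one)
open Summit.QuantumFields.YangMills.Theorems.FluctuationComparisonRegPrIntLLargeFieldGasEntropyCriterion (pinned_criterion_of_connected_cells_decay)
open Summit.QuantumFields.YangMills.Theorems.FluctuationComparisonRegPrIntLS2BetaKPLCriterion (exists_size_of_pinned_criterion)

namespace Summit.QuantumFields.YangMills.Theorems.FluctuationComparisonRegPrIntLKPGasOfBlockDecay

variable {P : Params} {μ : ℕ}

/-! ## §1 Footprints of touching-connected block families are never empty -/

open Classical in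
/-- A touching-connected family of blocks is nonempty and each block carries a bond, so its footprint is nonempty (`μ ≤ m + K`, `d ≥ 1`).
[cite: Balaban1989LargeFieldII, (1.84) p.386 (bookkeeping)] -/
theorem biUnion_cell_nonempty_of_connected (hd : 0 < P.d) (hμ : μ ≤ P.m + P.K) (Fc : Finset (Site P μ))
    (hc : ((touchingGraph (SiteTouch (P := P) (j := μ))).induce (Fc : Set (Site P μ))).Connected) :
    (Fc.biUnion (fun y => Finset.univ.filter (fun b : PBond P 0 => iterBlockOf μ b.src = y))).Nonempty := by
  obtain ⟨⟨y, hy⟩⟩ := hc.nonempty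
  refine ⟨⟨B15DeterminingSets.embIter μ y, ⟨0, hd⟩⟩, (mem_biUnion_cell_iff Fc _).mpr ?_⟩
  show iterBlockOf μ (B15DeterminingSets.embIter μ y) ∈ Fc
  rw [iterBlockOf_embIter hμ]; exact hy

/-! ## §2 The door -/

open Classical in
/-- ★★ **BLOCK-DECAYING ACTIVITIES ⟹ `KPGasOn W κ N w` (δ-unfolded; conclusion = ✓`kpGasOn_of_geometric`'s, token for token).**  On the bonds `PBond P 0` of any torus with `d ≥ 1`
and any grain `μ ≤ m + K`: V-local real activities vanishing at `∅` and, on the window, off the footprints `⋃_{y ∈ Fc} {b | B^μ(b.src) = y}` of touching-connected block families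
`Fc`, bounded there by `E₀·e^{−κμ·|Fc|}`, with `0 ≤ E₀ ≤ N`, `0 ≤ κ` and the rate row `E₀·d·L^{dμ} + κ·2d·L^μ + 2·log(3^d − 1) + 1 ≤ κμ`, form a Kotecký–Preiss gas on `W` at rate `κ`
of one-bond size `≤ N`; lengths = source-`tdist` diameters. [cite: Balaban1989LargeFieldII, (1.97)-(1.100) pp.389-390; Balaban1987RG1, (0.25) p.257; KoteckyPreiss1986, Theorem p.492 (1)] -/
theorem kpGasOn_of_blockDecay (hd : 0 < P.d) (hμ : μ ≤ P.m + P.K)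
    (W : Set (GaugeField P 0 (Matrix.specialUnitaryGroup (Fin 2) ℂ)))
    (w : GaugeField P 0 (Matrix.specialUnitaryGroup (Fin 2) ℂ) → Finset (PBond P 0) → ℝ) (hw0 : ∀ U, w U ∅ = 0)
    (hloc : ∀ (X : Finset (PBond P 0)) (U U' : GaugeField P 0 (Matrix.specialUnitaryGroup (Fin 2) ℂ)), (∀ e ∈ X, U e = U' e) → w U X = w U' X)
    (hsupp : ∀ U, U ∈ W → ∀ X : Finset (PBond P 0),
      (¬ ∃ Fc : Finset (Site P μ), ((touchingGraph (SiteTouch (P := P) (j := μ))).induce (Fc : Set (Site P μ))).Connected ∧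
          Fc.biUnion (fun y => Finset.univ.filter (fun b : PBond P 0 => iterBlockOf μ b.src = y)) = X) → w U X = 0)
    {E₀ κ κμ N : ℝ} (hE₀ : 0 ≤ E₀) (hE₀N : E₀ ≤ N) (hκ : 0 ≤ κ)
    (hbd : ∀ U, U ∈ W → ∀ (Fc : Finset (Site P μ)),
      ((touchingGraph (SiteTouch (P := P) (j := μ))).induce (Fc : Set (Site P μ))).Connected →
        |w U (Fc.biUnion (fun y => Finset.univ.filter (fun b : PBond P 0 => iterBlockOf μ b.src = y)))| ≤ E₀ * Real.exp (-(κμ * (Fc.card : ℝ))))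
    (hrate : E₀ * ((P.d * (P.L ^ P.d) ^ μ : ℕ) : ℝ) + κ * (2 * (P.d : ℝ) * (P.L : ℝ) ^ μ) + 2 * Real.log ((3 ^ P.d - 1 : ℕ) : ℝ) + 1 ≤ κμ) :
    ∃ (wbar a ℓ : Finset (PBond P 0) → ℝ),
      (∀ U, w U ∅ = 0) ∧
      (∀ (X : Finset (PBond P 0)) (U U' : GaugeField P 0 (Matrix.specialUnitaryGroup (Fin 2) ℂ)), (∀ e ∈ X, U e = U' e) → w U X = w U' X) ∧
      (∀ X, 0 ≤ a X) ∧ (∀ X, 0 ≤ ℓ X) ∧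
      (∀ U, U ∈ W → ∀ X, |w U X| ≤ wbar X) ∧
      (∀ X : Finset (PBond P 0), ∀ e ∈ X, ∀ e' ∈ X, (e.src.tdist e'.src : ℝ) ≤ ℓ X) ∧
      (∀ X : Finset (PBond P 0), ∑ X' ∈ Finset.univ.filter (fun X' => polyInc X' X),
          wbar X' * Real.exp (a X' + κ * ℓ X') ≤ a X) ∧
      (∀ e : PBond P 0, a {e} ≤ N) := by
  -- the footprint predicate, the size and the majorant
  set Foot : Finset (PBond P 0) → Prop := fun X => ∃ Fc : Finset (Site P μ),
      ((touchingGraph (SiteTouch (P := P) (j := μ))).induce (Fc : Set (Site P μ))).Connected ∧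
        Fc.biUnion (fun y => Finset.univ.filter (fun b : PBond P 0 => iterBlockOf μ b.src = y)) = X with hFoot
  set size : Finset (PBond P 0) → ℕ := fun X => (X.image (fun b : PBond P 0 => iterBlockOf μ b.src)).card with hsizeDef
  set wbar : Finset (PBond P 0) → ℝ := fun X => if Foot X then E₀ * Real.exp (-(κμ * (size X : ℝ))) else 0 with hwbar
  set ℓ : Finset (PBond P 0) → ℝ := fun X => ((X.sup fun a => X.sup fun a' => a.src.tdist a'.src : ℕ) : ℝ) with hℓ
  have hw0' : ∀ X, 0 ≤ wbar X := by
    intro X; simp only [hwbar]; split_ifs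
    · positivity
    · exact le_rfl
  have hℓ0 : ∀ X, 0 ≤ ℓ X := fun X => Nat.cast_nonneg _
  -- footprints are nonempty, so `w̄ ∅ = 0`
  have hFootE : ¬ Foot ∅ := by
    rintro ⟨Fc, hc, hX⟩
    have hne := biUnion_cell_nonempty_of_connected hd hμ Fc hc
    rw [hX] at hne
    exact Finset.not_nonempty_empty hne
  have hwe : wbar ∅ = 0 := by simp only [hwbar, if_neg hFootE]
  -- size of a footprint = number of blocks
  have hsize : ∀ X, wbar X ≠ 0 → ∃ Fc : Finset (Site P μ),
      ((touchingGraph (SiteTouch (P := P) (j := μ))).induce (Fc : Set (Site P μ))).Connected ∧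
        Fc.biUnion (fun y => Finset.univ.filter (fun b : PBond P 0 => iterBlockOf μ b.src = y)) = X ∧ Fc.card = size X := by
    intro X hX
    by_cases hF : Foot X
    · obtain ⟨Fc, hc, hFX⟩ := hF
      refine ⟨Fc, hc, hFX, ?_⟩
      rw [← hFX]
      exact (card_image_blk_biUnion_cell hd hμ Fc).symm
    · exact absurd (by simp only [hwbar, if_neg hF]) hX
  -- the length row on the support
  have hℓsupp : ∀ X, wbar X ≠ 0 → ℓ X ≤ (2 * (P.d : ℝ) * (P.L : ℝ) ^ μ) * (size X : ℝ) := by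
    intro X hX
    obtain ⟨Fc, hc, hFX, hFn⟩ := hsize X hX
    rw [← hFn, ← hFX]
    exact supDiam_biUnion_cell_le hμ Fc hc
  -- the decay row
  have hdec : ∀ X, wbar X ≤ E₀ * Real.exp (-(κμ * (size X : ℝ))) := by
    intro X; simp only [hwbar]; split_ifs
    · exact le_rfl
    · positivity
  -- domination on the window
  have hdom : ∀ U, U ∈ W → ∀ X, |w U X| ≤ wbar X := by
    intro U hU X
    by_cases hF : Foot X
    · obtain ⟨Fc, hc, hFX⟩ := hF
      have h1 := hbd U hU Fc hc
      rw [hFX] at h1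
      have hsz : (Fc.card : ℝ) = (size X : ℝ) := by
        rw [← hFX]
        exact_mod_cast (card_image_blk_biUnion_cell hd hμ Fc).symm
      have hwX : wbar X = E₀ * Real.exp (-(κμ * (size X : ℝ))) := by
        simp only [hwbar]
        exact if_pos ⟨Fc, hc, hFX⟩
      rw [hwX, ← hsz]; exact h1
    · rw [hsupp U hU X hF, abs_zero]; exact hw0' X
  -- the pinned criterion on block cells (prover-1's entropy–energy lemma with FILE 7's geometry)
  have hrate' : E₀ * ((P.d * (P.L ^ P.d) ^ μ : ℕ) : ℝ) + κ * (2 * (P.d : ℝ) * (P.L : ℝ) ^ μ) +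
      (Real.log ((1 : ℕ) : ℝ) + 2 * Real.log ((3 ^ P.d - 1 : ℕ) : ℝ)) + 1 ≤ κμ := by
    rw [Nat.cast_one, Real.log_one, zero_add]; exact hrate
  have hcrit := pinned_criterion_of_connected_cells_decay (B := PBond P 0) (touchingGraph (SiteTouch (P := P) (j := μ)))
    (fun y => degree_touchingGraph_siteTouch_le_pred y) (one_le_three_pow_sub_one hd)
    (fun y => Finset.univ.filter (fun b : PBond P 0 => iterBlockOf μ b.src = y)) card_filter_mem_cell_le_one le_rfl (card_cell_le hμ)
    wbar ℓ size κ E₀ κμ (2 * (P.d : ℝ) * (P.L : ℝ) ^ μ) hE₀ hκ hsize hℓsupp hdec hrate'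
  obtain ⟨a, ha0, hKP, hpin⟩ := exists_size_of_pinned_criterion wbar ℓ κ hE₀ hw0' hwe hcrit
  exact ⟨wbar, a, ℓ, hw0, hloc, ha0, hℓ0, hdom, fun X e he e' he' => footprint_hdiam X e he e' he', hKP, fun e => (hpin e).trans hE₀N⟩

end Summit.QuantumFields.YangMills.Theorems.FluctuationComparisonRegPrIntLKPGasOfBlockDecay

end
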